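import Literature.Barriers.PneNP.LowDegreeCounterexamples
import Literature.Computability.Complexity.CircuitInputMap
import Mathlib

/-!
# Coordinates on the class sub-cube `Q_{n,r}` — lemmas for the stub `stub_subcubeTransfer`

Crux `ArithStatLadder.AcZeroRung` (stmt-QuantumAdvantage-2425), line `dyadic-chirp-poisson`,
registered stub `stub_subcubeTransfer` (S3, "from the cube to weighted class sub-cubes"); this is
its helper file (registered anchor `card_classSubcube`), imported by
`ArithStatLadderAcZeroRungSubcubeTransfer.lean`. No definitions: the coordinate data are packaged
existentially (`exists_coords`, `exists_shift`, `exists_pmf`).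

RUNNING LOG. done: all lemmas, rc 0. next: land, then the stub file.

## Contents (namespace `SubcubeTransfer`)

* `testBit_ofFn`: the bits of the number with a prescribed bit string (`BitVec.ofBoolListLE`).
* COORDINATES `exists_coords`: for `n ≥ 6`, `r < 16` the class sub-cube
  `Q_{n,r} = {2^{n-1} ≤ d < 2^n : d ≡ r (mod 16)}` is parametrised by its free bits (positions
  `4 ≤ i ≤ n-2`): an injective `enc : {0,1}^{n-5} → ℕ` with image exactly `Q_{n,r}`
  (`enc z = 16·(2^{n-5} + Σ_j z_j 2^j) + r`), bit `j+4` of `enc z` equal to `z_j`, together with the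
  PROJECTION DATA for `Circuit.exists_project` — a partial assignment `ρ` (bits `0..3 := r`,
  bit `n-1 := 1`) and a renaming `π` of the free inputs with `(z ∘ π)|_ρ = bits (enc z)`.
* `card_classSubcube` (anchor): `#Q_{n,r} = 2^{n-5}` for `n ≥ 5`, `r < 16` (`card_Q_le` + an
  injection of `[2^{n-5}, 2^{n-4})`).
* `exists_shift`: a Walsh character of the free bits is a Walsh character of all bits on a set of
  free positions of the same size.
* `exists_pmf` (a nonnegative mass-one function is a `PMF`) and the exponent comparison
  `numerics : 4·L^A·n^{L^A}·2^M ≤ 2^{L^{A+2}}` for `n < 2^{L+1}`, `L ≥ M + 4`.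
-/

set_option linter.dupNamespace false -- D-0017: single-problem summit ⇒ QuantumAdvantage.QuantumAdvantage by design

noncomputable section

namespace Summit.QuantumAdvantage.QuantumAdvantage.Theorems.AcZeroRung

open Filter Finset
open Literature.Computability.Complexity
open Literature.Probability.RandomGraphs.LowDegree
open Literature.Barriers.PneNP (IsDWiseIndependent)

namespace SubcubeTransfer

/-- The bits of the number with prescribed bit string `f` (least significant first). -/
theorem testBit_ofFn {k : ℕ} (f : Fin k → Bool) (i : ℕ) :
    (BitVec.ofBoolListLE (List.ofFn f)).toNat.testBit i = if h : i < k then f ⟨i, h⟩ else false := by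
  rw [BitVec.testBit_toNat, BitVec.getLsbD_ofBoolListLE, List.getD_eq_getElem?_getD,
    List.getElem?_ofFn]
  split <;> simp

/-- `#Q_{n,r} ≤ 2^{n-5}`: `Q_{n,r}` lies in the image of `[2^{n-5}, 2^{n-4})` under `t ↦ 16t + r`. -/
theorem card_Q_le {n r : ℕ} (hn : 5 ≤ n) :
    ((Finset.Ico (2 ^ (n - 1)) (2 ^ n)).filter (fun d => d % 16 = r)).card ≤ 2 ^ (n - 5) := by
  have h1 : 2 ^ (n - 1) = 2 ^ 4 * 2 ^ (n - 5) := by rw [← pow_add]; congr 1; omega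
  have h2 : 2 ^ n = 2 ^ 4 * 2 ^ (n - 5 + 1) := by rw [← pow_add]; congr 1; omega
  have h16 : (2 : ℕ) ^ 4 = 16 := by norm_num
  rw [h16] at h1 h2
  calc ((Finset.Ico (2 ^ (n - 1)) (2 ^ n)).filter (fun d => d % 16 = r)).card
      ≤ ((Finset.Ico (2 ^ (n - 5)) (2 ^ (n - 5 + 1))).image (fun t => 16 * t + r)).card := by
        refine Finset.card_le_card (fun d hd => ?_)
        rw [Finset.mem_filter, Finset.mem_Ico] at hd
        rw [Finset.mem_image]
        refine ⟨d / 16, ?_, ?_⟩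
        · rw [Finset.mem_Ico, pow_succ]; omega
        · omega
    _ ≤ (Finset.Ico (2 ^ (n - 5)) (2 ^ (n - 5 + 1))).card := Finset.card_image_le
    _ = 2 ^ (n - 5) := by rw [Nat.card_Ico, pow_succ]; omega

/-- COORDINATES from a bit-string encoder `v` of the free bits followed by the top bit: the map
`z ↦ 16·v(z) + r` is injective onto `Q_{n,r}`, has free bits `z`, and is reconstructed from `z` by
hard-wiring bits `0..3 := r`, `n-1 := 1` and renaming the free inputs `i ↦ i - 4`. -/
theorem coords_of_spec {n r : ℕ} (hn : 6 ≤ n) (hr : r < 16) (v : (Fin (n - 5) → Bool) → ℕ)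
    (hv : ∀ z j, (v z).testBit j = if h : j < n - 5 then z ⟨j, h⟩ else decide (j = n - 5)) :
    Function.Injective (fun z => 2 ^ 4 * v z + r) ∧
    (Finset.univ.image (fun z => 2 ^ 4 * v z + r) =
      (Finset.Ico (2 ^ (n - 1)) (2 ^ n)).filter (fun d => d % 16 = r)) ∧
    (∀ z (j : Fin (n - 5)), (2 ^ 4 * v z + r).testBit ((j : ℕ) + 4) = z j) ∧
    ∀ z, restrictInput (fun i : Fin n => if (i : ℕ) < 4 then some (r.testBit i)
        else if (i : ℕ) + 1 = n then some true else none)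
      (fun i : Fin n => z ⟨min ((i : ℕ) - 4) (n - 6), by omega⟩) =
      fun i : Fin n => (2 ^ 4 * v z + r).testBit i := by
  have hvlt : ∀ z, v z < 2 ^ (n - 5 + 1) := fun z =>
    Nat.lt_pow_two_of_testBit _ fun i hi => by
      rw [hv, dif_neg (by omega), decide_eq_false_iff_not]
      omega
  have hvge : ∀ z, 2 ^ (n - 5) ≤ v z := fun z =>
    Nat.ge_two_pow_of_testBit (by rw [hv, dif_neg (lt_irrefl _), decide_eq_true_eq])
  have hbit : ∀ z j, (2 ^ 4 * v z + r).testBit j =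
      if j < 4 then r.testBit j else (v z).testBit (j - 4) :=
    fun z j => Nat.testBit_two_pow_mul_add _ (by norm_num; exact hr) j
  have hfree : ∀ z (j : Fin (n - 5)), (2 ^ 4 * v z + r).testBit ((j : ℕ) + 4) = z j := fun z j => by
    rw [hbit, if_neg (by omega), Nat.add_sub_cancel, hv, dif_pos j.isLt]
  have htop : ∀ z, (2 ^ 4 * v z + r).testBit (n - 1) = true := fun z => by
    rw [hbit, if_neg (by omega), show n - 1 - 4 = n - 5 by omega, hv, dif_neg (lt_irrefl _),
      decide_eq_true_eq]
  have hinj : Function.Injective (fun z => 2 ^ 4 * v z + r) := fun z z' h => funext fun j => by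
    rw [← hfree z j, ← hfree z' j]
    exact congrArg (fun d => Nat.testBit d ((j : ℕ) + 4)) h
  have hmem : ∀ z, 2 ^ 4 * v z + r ∈ (Finset.Ico (2 ^ (n - 1)) (2 ^ n)).filter (fun d => d % 16 = r) := by
    have h1 : 2 ^ (n - 1) = 2 ^ 4 * 2 ^ (n - 5) := by rw [← pow_add]; congr 1; omega
    have h2 : 2 ^ n = 2 ^ 4 * 2 ^ (n - 5 + 1) := by rw [← pow_add]; congr 1; omega
    have h16 : (2 : ℕ) ^ 4 = 16 := by norm_num
    intro z
    have hl := hvlt z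
    have hg := hvge z
    rw [Finset.mem_filter, Finset.mem_Ico, h1, h2, h16]
    rw [h16] at h1 h2
    omega
  refine ⟨hinj, ?_, hfree, fun z => funext fun i => ?_⟩
  · refine Finset.eq_of_subset_of_card_le (fun d hd => ?_) ?_
    · obtain ⟨z, _, rfl⟩ := Finset.mem_image.1 hd
      exact hmem z
    · rw [Finset.card_image_of_injective _ hinj, Finset.card_univ, Fintype.card_fun,
        Fintype.card_bool, Fintype.card_fin]
      exact card_Q_le (by omega)
  · simp only [restrictInput]
    split_ifs with h1 h2
    · rw [Option.getD_some, hbit, if_pos h1]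
    · have hi : (i : ℕ) = n - 1 := by omega
      rw [Option.getD_some, hi, htop]
    · have hi : (i : ℕ) - 4 < n - 5 := by omega
      rw [Option.getD_none, hbit, if_neg h1, hv, dif_pos hi]
      congr 1
      ext
      simp only
      omega

/-- **COORDINATES ON THE CLASS SUB-CUBE** (`n ≥ 6`, `r < 16`): an injective parametrisation
`enc : {0,1}^{n-5} → ℕ` of `Q_{n,r} = {2^{n-1} ≤ d < 2^n : d ≡ r (mod 16)}` by the free bits
(bit `j + 4` of `enc z` is `z j`), and projection data `ρ, π` (hard-wired bits `0..3 := r`,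
`n-1 := 1`; free inputs renamed) with `(z ∘ π)|_ρ = bits (enc z)`. -/
theorem exists_coords {n r : ℕ} (hn : 6 ≤ n) (hr : r < 16) :
    ∃ (enc : (Fin (n - 5) → Bool) → ℕ) (ρ : Fin n → Option Bool) (π : Fin n → Fin (n - 5)),
      Function.Injective enc ∧
      Finset.univ.image enc = (Finset.Ico (2 ^ (n - 1)) (2 ^ n)).filter (fun d => d % 16 = r) ∧
      (∀ z (j : Fin (n - 5)), (enc z).testBit ((j : ℕ) + 4) = z j) ∧
      ∀ z, restrictInput ρ (fun i => z (π i)) = fun i : Fin n => (enc z).testBit i := by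
  obtain ⟨h1, h2, h3, h4⟩ := coords_of_spec hn hr
    (fun z => (BitVec.ofBoolListLE (List.ofFn
      fun i : Fin (n - 5 + 1) => if h : (i : ℕ) < n - 5 then z ⟨i, h⟩ else true)).toNat)
    (fun z j => by
      rw [testBit_ofFn]
      by_cases hj : j < n - 5
      · rw [dif_pos (by omega), dif_pos hj, dif_pos hj]
      · by_cases hj' : j = n - 5
        · subst hj'
          rw [dif_pos (by omega), dif_neg hj]
          simp
        · rw [dif_neg (by omega), dif_neg hj, eq_comm, decide_eq_false_iff_not]
          exact hj')
  exact ⟨_, _, _, h1, h2, h3, h4⟩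

/-- `#Q_{n,r} = 2^{n-5}`, i.e. `2^{n-5} ≤ #Q_{n,r}` by the injection `t ↦ 16 t + r` of
`[2^{n-5}, 2^{n-4})`. -/
theorem le_card_Q {n r : ℕ} (hn : 5 ≤ n) (hr : r < 16) :
    2 ^ (n - 5) ≤ ((Finset.Ico (2 ^ (n - 1)) (2 ^ n)).filter (fun d => d % 16 = r)).card := by
  have h1 : 2 ^ (n - 1) = 2 ^ 4 * 2 ^ (n - 5) := by rw [← pow_add]; congr 1; omega
  have h2 : 2 ^ n = 2 ^ 4 * 2 ^ (n - 5 + 1) := by rw [← pow_add]; congr 1; omega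
  have h16 : (2 : ℕ) ^ 4 = 16 := by norm_num
  rw [h16] at h1 h2
  calc 2 ^ (n - 5) = (Finset.Ico (2 ^ (n - 5)) (2 ^ (n - 5 + 1))).card := by
        rw [Nat.card_Ico, pow_succ]; omega
    _ ≤ ((Finset.Ico (2 ^ (n - 1)) (2 ^ n)).filter (fun d => d % 16 = r)).card := by
        refine Finset.card_le_card_of_injOn (fun t => 16 * t + r) (fun t ht => ?_)
          (fun a _ b _ h => ?_)
        · rw [Finset.coe_Ico, Set.mem_Ico, pow_succ] at ht
          show 16 * t + r ∈ _
          rw [Finset.mem_coe, Finset.mem_filter, Finset.mem_Ico]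
          omega
        · simp only at h
          omega

/-- A Walsh character of the free bits is a Walsh character of all bits on a nonempty set of free
positions `4 ≤ i ≤ n-2` of the same size (the shift `j ↦ j + 4`). -/
theorem exists_shift {n : ℕ} (T : Finset (Fin (n - 5))) (hT : T.Nonempty) :
    ∃ S : Finset (Fin n), S.Nonempty ∧ S.card = T.card ∧
      (∀ i ∈ S, 4 ≤ (i : ℕ) ∧ (i : ℕ) + 1 < n) ∧
      ∀ x : Fin n → Bool, walsh S x = walsh T (fun j => x ⟨(j : ℕ) + 4, by omega⟩) := by
  let sh : Fin (n - 5) ↪ Fin n := ⟨fun j => ⟨(j : ℕ) + 4, by omega⟩, fun a b h => by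
    have := congrArg Fin.val h
    simp only at this
    exact Fin.ext (by omega)⟩
  refine ⟨T.map sh, Finset.map_nonempty.2 hT, Finset.card_map _, fun i hi => ?_, fun x => ?_⟩
  · obtain ⟨j, _, rfl⟩ := Finset.mem_map.1 hi
    show 4 ≤ (j : ℕ) + 4 ∧ (j : ℕ) + 4 + 1 < n
    omega
  · rw [walsh, walsh, Finset.prod_map]
    rfl

/-- A nonnegative real function of total mass `1` on a finite type is (the `toReal` of) a `PMF`. -/
theorem exists_pmf {ι : Type} [Fintype ι] (a : ι → ℝ) (ha : ∀ x, 0 ≤ a x) (hsum : ∑ x, a x = 1) :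
    ∃ ν : PMF ι, ∀ x, (ν x).toReal = a x := by
  refine ⟨PMF.ofFintype (fun x => ENNReal.ofReal (a x)) ?_, fun x => ?_⟩
  · rw [← ENNReal.ofReal_sum_of_nonneg (fun x _ => ha x), hsum, ENNReal.ofReal_one]
  · rw [PMF.ofFintype_apply, ENNReal.toReal_ofReal (ha x)]

/-- The exponent comparison: `4 · K · n^K · 2^M ≤ 2^{L^{A+2}}` for `K = L^A`, `n < 2^{L+1}`,
`L ≥ M + 4`. -/
theorem numerics (A M : ℕ) {n L : ℕ} (hnL : n < 2 ^ (L + 1)) (hL : M + 4 ≤ L) :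
    4 * (L ^ A * n ^ (L ^ A)) * 2 ^ M ≤ 2 ^ (L ^ (A + 2)) := by
  set K := L ^ A with hK
  have hKlt : K < 2 ^ K := Nat.lt_two_pow_self
  have h1 : n ^ K ≤ 2 ^ ((L + 1) * K) := by
    rw [pow_mul]
    exact Nat.pow_le_pow_left hnL.le K
  have hexp : 2 + K + (L + 1) * K + M ≤ L ^ (A + 2) := by
    have hK1 : 1 ≤ K := Nat.one_le_pow _ _ (by omega)
    have hLL : (L + 2) + (M + 2) ≤ L * L := by nlinarith
    calc 2 + K + (L + 1) * K + M = (L + 2) * K + (M + 2) := by ring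
      _ ≤ (L + 2) * K + (M + 2) * K := by nlinarith
      _ = K * ((L + 2) + (M + 2)) := by ring
      _ ≤ K * (L * L) := Nat.mul_le_mul_left _ hLL
      _ = L ^ (A + 2) := by rw [hK, pow_add, pow_two]
  calc 4 * (K * n ^ K) * 2 ^ M ≤ 4 * (2 ^ K * 2 ^ ((L + 1) * K)) * 2 ^ M := by gcongr
    _ = 2 ^ (2 + K + (L + 1) * K + M) := by ring
    _ ≤ 2 ^ (L ^ (A + 2)) := Nat.pow_le_pow_right (by norm_num) hexp

end SubcubeTransfer

/-- **The class sub-cube has `2^{n-5}` elements**: for `n ≥ 5` and `r < 16`,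
`#{2^{n-1} ≤ d < 2^n : d ≡ r (mod 16)} = 2^{n-5}` (registered anchor of this helper file). -/
theorem card_classSubcube : ∀ n r : ℕ, 5 ≤ n → r < 16 →
    ((Finset.Ico (2 ^ (n - 1)) (2 ^ n)).filter (fun d => d % 16 = r)).card = 2 ^ (n - 5) :=
  fun _ _ hn hr => le_antisymm (SubcubeTransfer.card_Q_le hn) (SubcubeTransfer.le_card_Q hn hr)

end Summit.QuantumAdvantage.QuantumAdvantage.Theorems.AcZeroRung

end
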